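import Summits.QuantumFields.YangMills.Theorems.LuscherReductionTwistedTraceScalingBOStiffCore
import Summits.QuantumFields.YangMills.Theorems.LuscherReductionTwistedTraceScalingBOStiffAssembly
import Summits.QuantumFields.YangMills.Theorems.LuscherReductionTwistedTraceScalingBORecordInputOfST
import HarnessLib

/-!
# (B-ST) (W1-8) `…BOStiffHST`: ★★★ `hST_record_of_specs` and `recordAnalyticInput_of_specs` — the (B-ST) stiff-mode tube Poincaré inequality of record, CONDITIONAL on the two fibre-block specs
# (lane A of S-BASE, crux `TwistedTraceScaling` stmt-QuantumFields-20203, C4-CORE, the (B-ST) pen; HANDOFF-g21 UPDATE 20:39Z (W1-8))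

From ✓`…BOStiffCore.hcore_record_of_specs` (core piece `≤ (1 − 4θ₀)Λ_rec`, `θ₀ = θ_*/64`), ✓`…BOStiffTailsRecord.hfar_record` / `hshell_record` (tails `≤ εΛ_rec`, any `ε > 0`; here `ε = θ₀²/16`),
✓`…BOStiffAssembly.pieces_budget` and ✓`hST_of_pieces`:
★★★ `hST_record_of_specs` — assuming the conclusions of `spec_S3` and `spec_gap_inputs` (HOME/ym-luscher-20007-p1/g21-FibreBlock-spec.lean, verbatim), `∃ M₀ ≥ 2, ∀ M ≥ M₀, ∃ θ₀ ∈ (0,1],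
∀ᶠ β, HST(β, θ₀, M)` — the LITERAL `hST` hypothesis of ✓`…BORecordInputOfST.recordAnalyticInput_of_hST`; ★★★ `recordAnalyticInput_of_specs` — hence `Nonempty (RecordAnalyticInput L s M)`
for `1/6 < s < 1/4` and all large `M`, conditional on the two specs alone.
HONEST FRAMING: bookkeeping for a stub of a child of the CONDITIONAL route R2b1, CONDITIONAL on the two analytic specs (A),(B) of the lead's fibre block; (B-ST) OPEN until they land;
C4-CORE OPEN; not infinite volume, not a gap, not Clay.
-/

set_option autoImplicit false

noncomputable section

open MeasureTheory Filter Topology Real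
open scoped BigOperators
open Literature.MathematicalPhysics.QuantumFieldTheory
open Literature.MathematicalPhysics.QuantumLattice

namespace Summit.QuantumFields.YangMills.Theorems.FemtoTransferGap.TwoLattice.ConstTube

open Summit.QuantumFields.YangMills.Theorems.FemtoTransferGap
open Summit.QuantumFields.YangMills.Theorems.FemtoTransferGap.TwoLattice
open Summit.QuantumFields.YangMills.Theorems.FemtoTransferGap.TwoLattice.Avg
open Summit.QuantumFields.YangMills.Theorems.FemtoTransferGap.TwoLattice.Stiff (LinkSpace)
open Summit.QuantumFields.YangMills.Theorems.FemtoTransferGap.TwoLattice.GnChart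

variable {L : ℕ} [NeZero L]

set_option maxHeartbeats 3200000 in
-- the full record assembly.
/-- ★★★ **`hST` OF RECORD FROM THE TWO FIBRE-BLOCK SPECS** (see the module docstring). [cite: Luscher1983, §3] [cite: SeilerLNP1982, §3] -/
theorem hST_record_of_specs (hLz : Nonempty (NzSite L)) (hL2 : 2 ≤ L) {s : ℝ} (hs6 : 1 / 6 < s) (hs4 : s < 1 / 4)
    (hS3 : ∃ M₀ : ℝ, 2 ≤ M₀ ∧ ∀ M : ℝ, M₀ ≤ M → ∀ η : ℝ, 0 < η → ∀ η₂ : ℝ, 0 < η₂ → ∀ᶠ β : ℝ in atTop,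
      (∀ x ∈ cS L β, ∫ y, cM L β x y * cΘ L β y ∂orthoTransverse L ≤ (1 + η) * cΛ L s M β * (cΘ L β x * cW L s M β x)) ∧
      (∫ x in cS L β, ((∫ y, cM L β x y * cΘ L β y ∂orthoTransverse L) - cΛ L s M β * (cΘ L β x * cW L s M β x)) ^ 2 / cW L s M β x ∂orthoTransverse L ≤
        (η₂ * cΛ L s M β) ^ 2 * ∫ x, cΘ L β x ^ 2 * cW L s M β x ∂orthoTransverse L))
    (hGI : ∃ M₀ : ℝ, 2 ≤ M₀ ∧ ∀ M : ℝ, M₀ ≤ M → ∃ P₀ Cν C'ν cJ : ℝ, 0 < P₀ ∧ 0 < Cν ∧ 0 < C'ν ∧ 0 < cJ ∧ cJ / (Cν * P₀) ≤ 1 ∧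
      ∀ δ : ℝ, 0 < δ → ∀ᶠ β : ℝ in atTop, ∃ (D : (Edge 3 L → Fin 3 → ℝ) → ℝ) (J₀ : (Edge 3 L → Fin 3 → ℝ) → (Edge 3 L → Fin 3 → ℝ) → ℝ) (θ₀ CD CJ : ℝ),
        Measurable D ∧ (∀ x, |D x| ≤ CD) ∧ Measurable (Function.uncurry J₀) ∧ (∀ x y, |J₀ x y| ≤ CJ) ∧ 0 < θ₀ ∧ (∀ x ∈ cS L β, θ₀ ≤ cΘ L β x) ∧
        0 < ∫ x in cS L β, D x ∂orthoTransverse L ∧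
        (∀ x ∈ cS L β, cΘ L β x ^ 2 * cW L s M β x ≤ Cν * D x) ∧ (∀ x ∈ cS L β, D x ≤ C'ν * (cΘ L β x ^ 2 * cW L s M β x)) ∧
        (∀ x y, cJ * (cΛ L s M β * J₀ x y) ≤ cΘ L β x * cM L β x y * cΘ L β y) ∧
        (∀ g : (Edge 3 L → Fin 3 → ℝ) → ℝ, Measurable g → (∃ C : ℝ, ∀ x, |g x| ≤ C) → (∀ x, x ∉ cS L β → g x = 0) →
          (∫ x in cS L β, g x ^ 2 * D x ∂orthoTransverse L) - (∫ x in cS L β, g x * D x ∂orthoTransverse L) ^ 2 / (∫ x in cS L β, D x ∂orthoTransverse L) ≤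
            P₀ * ((1 / 2) * ∫ x, ∫ y, (g x - g y) ^ 2 * J₀ x y ∂orthoTransverse L ∂orthoTransverse L) + δ * ∫ x in cS L β, g x ^ 2 * D x ∂orthoTransverse L)) :
    ∃ M₀ : ℝ, 2 ≤ M₀ ∧ ∀ M : ℝ, M₀ ≤ M → ∃ θ₀ : ℝ, (0 < θ₀ ∧ θ₀ ≤ 1) ∧
      ∀ᶠ β : ℝ in atTop, ∀ v : GaugeConfig 3 L SU2 → ℝ, Measurable v → (∃ C : ℝ, ∀ U, |v U| ≤ C) → (∀ U, v U ≠ 0 → (recordChi L s 43 M β) U ≠ 0) → (∀ u, fibreInner L (softWeight (recordChi L s 43 M β)) (fun x : LinkSpace L => {x : LinkSpace L | linkCurry x ∈ capBalancedSet L}.indicator (fun _ => (1 : ℝ)) x * frozenProfile L (fun β' => stiffGaussExp L (β' / 2) β') (fun β' => min (1 / 40) (powScale (1 / 2) β' * btLog β')) β x) v u = 0) → tubeForm β v ≤ (1 - θ₀) * ((btC L β (fun x : LinkSpace L => {x : LinkSpace L | linkCurry x ∈ capBalancedSet L}.indicator (fun _ => (1 : ℝ)) x * frozenProfile L (fun β'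 => stiffGaussExp L (β' / 2) β') (fun β' => min (1 / 40) (powScale (1 / 2) β' * btLog β')) β x) (btEps β) (5 * (powScale (1 / 2) β * btLog β ^ 2)) / fpZ (btEps β) / recordGamma L (fun β' => fun x : LinkSpace L => {x : LinkSpace L | linkCurry x ∈ capBalancedSet L}.indicator (fun _ => (1 : ℝ)) x * frozenProfile L (fun β'' => stiffGaussExp L (β'' / 2) β'') (fun β'' => min (1 / 40) (powScale (1 / 2) β'' * btLog β'')) β' x) β) * levelValue su2Rep 1 ((L : ℝ) ^ 3 * β) 0) * tubeNormSq (softWeight (recordChi L s 43 M β)) v := by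
  have hs : 0 < s := by linarith
  have hs3 : s ≤ 1 / 3 := by linarith
  obtain ⟨Mc, hMc, Hc⟩ := hcore_record_of_specs (L := L) hLz hL2 hs6 hs4 hS3 hGI
  obtain ⟨Mf, hMf, Hf⟩ := hfar_record (L := L) hLz hs hs3
  obtain ⟨cΛf, Kf, hcΛf, hfloorΛ⟩ := recordLambda_floor (L := L)
  refine ⟨max Mc Mf, le_trans hMc (le_max_left _ _), fun M hM => ?_⟩
  have hMc' : Mc ≤ M := le_trans (le_max_left _ _) hM
  have hMf' : Mf ≤ M := le_trans (le_max_right _ _) hM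
  have hM0 : 0 ≤ M := le_trans (by norm_num) (hMc.trans hMc')
  obtain ⟨θ₀, hθ₀, hθ₀1, Hcβ⟩ := Hc M hMc'
  refine ⟨θ₀, ⟨hθ₀, by linarith⟩, ?_⟩
  have hε : 0 < θ₀ ^ 2 / 16 := by positivity
  filter_upwards [Hcβ, Hf M hMf' (θ₀ ^ 2 / 16) hε, hshell_record (L := L) hL2 hs hM0 hε, eventually_ge_atTop (0 : ℝ), hfloorΛ] with β hc hf hsh hβ0 hΛfl
    v hv hC hsupp hadm
  obtain ⟨-, -, hw0, -⟩ := softWeight_recordChi_props (L := L) s 43 M β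
  have hΛ0 : 0 ≤ (btC L β (fun x : LinkSpace L => {x : LinkSpace L | linkCurry x ∈ capBalancedSet L}.indicator (fun _ => (1 : ℝ)) x * frozenProfile L (fun β' => stiffGaussExp L (β' / 2) β') (fun β' => min (1 / 40) (powScale (1 / 2) β' * btLog β')) β x) (btEps β) (5 * (powScale (1 / 2) β * btLog β ^ 2)) / fpZ (btEps β) / recordGamma L (fun β' => fun x : LinkSpace L => {x : LinkSpace L | linkCurry x ∈ capBalancedSet L}.indicator (fun _ => (1 : ℝ)) x * frozenProfile L (fun β'' => stiffGaussExp L (β'' / 2) β'') (fun β'' => min (1 / 40) (powScale (1 / 2) β'' * btLog β'')) β' x) β *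
            levelValue su2Rep 1 ((L : ℝ) ^ 3 * β) 0) :=
    le_trans (mul_nonneg (mul_nonneg hcΛf.le (pow_nonneg (powScale_pos 1 β).le _)) (pow_nonneg (Real.exp_pos _).le _)) hΛfl
  have hS₂ : MeasurableSet {U : GaugeConfig 3 L SU2 | powScale 1 β * btLog β < ‖(gaugeModes L).starProjection (relLinkVec L U)‖} := measurableSet_far_record (L := L) _
  have hS₃ : MeasurableSet {U : GaugeConfig 3 L SU2 | min (1 / 40) (powScale (1 / 2) β * btLog β) / 2 < ‖relLinkVec L U‖} := measurableSet_shell_record (L := L) _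
  have habc := pieces_budget (Λ := (btC L β (fun x : LinkSpace L => {x : LinkSpace L | linkCurry x ∈ capBalancedSet L}.indicator (fun _ => (1 : ℝ)) x * frozenProfile L (fun β' => stiffGaussExp L (β' / 2) β') (fun β' => min (1 / 40) (powScale (1 / 2) β' * btLog β')) β x) (btEps β) (5 * (powScale (1 / 2) β * btLog β ^ 2)) / fpZ (btEps β) / recordGamma L (fun β' => fun x : LinkSpace L => {x : LinkSpace L | linkCurry x ∈ capBalancedSet L}.indicator (fun _ => (1 : ℝ)) x * frozenProfile L (fun β'' => stiffGaussExp L (β'' / 2) β'') (fun β'' => min (1 / 40) (powScale (1 / 2) β'' * btLog β'')) β' x) β *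
            levelValue su2Rep 1 ((L : ℝ) ^ 3 * β) 0))
    hΛ0 hθ₀ (by linarith) hε.le (by nlinarith) (le_refl ((1 - 4 * θ₀) * _)) (le_refl (θ₀ ^ 2 / 16 * _)) (le_refl (θ₀ ^ 2 / 16 * _))
  have ha₁ : 0 ≤ (1 - 4 * θ₀) * (btC L β (fun x : LinkSpace L => {x : LinkSpace L | linkCurry x ∈ capBalancedSet L}.indicator (fun _ => (1 : ℝ)) x * frozenProfile L (fun β' => stiffGaussExp L (β' / 2) β') (fun β' => min (1 / 40) (powScale (1 / 2) β' * btLog β')) β x) (btEps β) (5 * (powScale (1 / 2) β * btLog β ^ 2)) / fpZ (btEps β) / recordGamma L (fun β' => fun x : LinkSpace L => {x : LinkSpace L | linkCurry x ∈ capBalancedSet L}.indicator (fun _ => (1 : ℝ)) x * frozenProfile L (fun β'' => stiffGaussExp L (β'' / 2) β'') (fun β'' => min (1 / 40) (powScale (1 / 2) β'' * btLog β'')) β' x) β *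
            levelValue su2Rep 1 ((L : ℝ) ^ 3 * β) 0) := mul_nonneg (by linarith) hΛ0
  have ha₂ : 0 ≤ θ₀ ^ 2 / 16 * (btC L β (fun x : LinkSpace L => {x : LinkSpace L | linkCurry x ∈ capBalancedSet L}.indicator (fun _ => (1 : ℝ)) x * frozenProfile L (fun β' => stiffGaussExp L (β' / 2) β') (fun β' => min (1 / 40) (powScale (1 / 2) β' * btLog β')) β x) (btEps β) (5 * (powScale (1 / 2) β * btLog β ^ 2)) / fpZ (btEps β) / recordGamma L (fun β' => fun x : LinkSpace L => {x : LinkSpace L | linkCurry x ∈ capBalancedSet L}.indicator (fun _ => (1 : ℝ)) x * frozenProfile L (fun β'' => stiffGaussExp L (β'' / 2) β'') (fun β'' => min (1 / 40) (powScale (1 / 2) β'' * btLog β'')) β' x) β *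
            levelValue su2Rep 1 ((L : ℝ) ^ 3 * β) 0) := mul_nonneg hε.le hΛ0
  set Adm : (GaugeConfig 3 L SU2 → ℝ) → Prop := fun v => ∀ u : GaugeConfig 3 1 SU2, fibreInner L (softWeight (recordChi L s 43 M β)) (fun x : LinkSpace L => {x : LinkSpace L | linkCurry x ∈ capBalancedSet L}.indicator (fun _ => (1 : ℝ)) x *
          frozenProfile L (fun β' => stiffGaussExp L (β' / 2) β') (fun β' => min (1 / 40) (powScale (1 / 2) β' * btLog β')) β x) v u = 0
    with hAdm
  have hadm' : Adm v := hadm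
  exact hST_of_pieces (L := L) hβ0 hw0 Adm hS₂ hS₃ ha₁ ha₂ ha₂ habc (fun v hv hC hsupp hadm => hc v hv hC hsupp hadm) (fun v hv hC hsupp hadm => hf Adm v hv hC hsupp hadm)
    (fun v hv hC hsupp hadm => hsh Adm v hv hC hsupp hadm) v hv hC hsupp hadm'

set_option maxHeartbeats 1600000 in
-- the full record assembly.
/-- ★★★ **`RecordAnalyticInput` FROM THE TWO FIBRE-BLOCK SPECS**: for `1/6 < s < 1/4` (and `NzSite L` nonempty, `L ≥ 2`), assuming the conclusions of `spec_S3` and `spec_gap_inputs`,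
`∃ M₀ ≥ 2, ∀ M ≥ M₀, Nonempty (RecordAnalyticInput L s M)` — ✓`recordAnalyticInput_of_hST` ∘ `hST_record_of_specs`. [cite: Luscher1983, §3] [cite: SjostrandZworski2007, §2] -/
theorem recordAnalyticInput_of_specs (hLz : Nonempty (NzSite L)) (hL2 : 2 ≤ L) {s : ℝ} (hs6 : 1 / 6 < s) (hs4 : s < 1 / 4)
    (hS3 : ∃ M₀ : ℝ, 2 ≤ M₀ ∧ ∀ M : ℝ, M₀ ≤ M → ∀ η : ℝ, 0 < η → ∀ η₂ : ℝ, 0 < η₂ → ∀ᶠ β : ℝ in atTop,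
      (∀ x ∈ cS L β, ∫ y, cM L β x y * cΘ L β y ∂orthoTransverse L ≤ (1 + η) * cΛ L s M β * (cΘ L β x * cW L s M β x)) ∧
      (∫ x in cS L β, ((∫ y, cM L β x y * cΘ L β y ∂orthoTransverse L) - cΛ L s M β * (cΘ L β x * cW L s M β x)) ^ 2 / cW L s M β x ∂orthoTransverse L ≤
        (η₂ * cΛ L s M β) ^ 2 * ∫ x, cΘ L β x ^ 2 * cW L s M β x ∂orthoTransverse L))
    (hGI : ∃ M₀ : ℝ, 2 ≤ M₀ ∧ ∀ M : ℝ, M₀ ≤ M → ∃ P₀ Cν C'ν cJ : ℝ, 0 < P₀ ∧ 0 < Cν ∧ 0 < C'ν ∧ 0 < cJ ∧ cJ / (Cν * P₀) ≤ 1 ∧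
      ∀ δ : ℝ, 0 < δ → ∀ᶠ β : ℝ in atTop, ∃ (D : (Edge 3 L → Fin 3 → ℝ) → ℝ) (J₀ : (Edge 3 L → Fin 3 → ℝ) → (Edge 3 L → Fin 3 → ℝ) → ℝ) (θ₀ CD CJ : ℝ),
        Measurable D ∧ (∀ x, |D x| ≤ CD) ∧ Measurable (Function.uncurry J₀) ∧ (∀ x y, |J₀ x y| ≤ CJ) ∧ 0 < θ₀ ∧ (∀ x ∈ cS L β, θ₀ ≤ cΘ L β x) ∧
        0 < ∫ x in cS L β, D x ∂orthoTransverse L ∧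
        (∀ x ∈ cS L β, cΘ L β x ^ 2 * cW L s M β x ≤ Cν * D x) ∧ (∀ x ∈ cS L β, D x ≤ C'ν * (cΘ L β x ^ 2 * cW L s M β x)) ∧
        (∀ x y, cJ * (cΛ L s M β * J₀ x y) ≤ cΘ L β x * cM L β x y * cΘ L β y) ∧
        (∀ g : (Edge 3 L → Fin 3 → ℝ) → ℝ, Measurable g → (∃ C : ℝ, ∀ x, |g x| ≤ C) → (∀ x, x ∉ cS L β → g x = 0) →
          (∫ x in cS L β, g x ^ 2 * D x ∂orthoTransverse L) - (∫ x in cS L β, g x * D x ∂orthoTransverse L) ^ 2 / (∫ x in cS L β, D x ∂orthoTransverse L) ≤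
            P₀ * ((1 / 2) * ∫ x, ∫ y, (g x - g y) ^ 2 * J₀ x y ∂orthoTransverse L ∂orthoTransverse L) + δ * ∫ x in cS L β, g x ^ 2 * D x ∂orthoTransverse L)) :
    ∃ M₀ : ℝ, 2 ≤ M₀ ∧ ∀ M : ℝ, M₀ ≤ M → Nonempty (RecordAnalyticInput L s M) := by
  obtain ⟨M₁, hM₁, H1⟩ := recordAnalyticInput_of_hST (L := L) hLz hL2 hs6 hs4
  obtain ⟨M₂, hM₂, H2⟩ := hST_record_of_specs (L := L) hLz hL2 hs6 hs4 hS3 hGI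
  refine ⟨max M₁ M₂, le_trans hM₁ (le_max_left _ _), fun M hM => ?_⟩
  obtain ⟨θ₀, hθ₀, hST⟩ := H2 M (le_trans (le_max_right _ _) hM)
  exact H1 M (le_trans (le_max_left _ _) hM) θ₀ hθ₀ hST

end Summit.QuantumFields.YangMills.Theorems.FemtoTransferGap.TwoLattice.ConstTube

end
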